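import Summits.QuantumFields.YangMills.Theorems.BalabanLadderNTMirrorHankelMirrorForm
import HarnessLib

/-!
# Crux `NT` (stmt-QuantumFields-19353): a mirror floor propagates INWARD — losslessly in the large-torus limit

Helper file (`--supports stmt-QuantumFields-19353`) of the fleet lead prover of crux `NT` (unit `ym-spine-19353-p1`,
g11), hypothesis-free; sequel of the mirror-Hankel series of g10 (`…NTMirrorHankelShift` / `…Hankel` / `…Convex` /
`…Torus` / `…Cap` / `…MirrorForm`).  There: on every odd torus `(ℤ/(2S+1)ℤ)^d` (every compact `G`, continuous unitary
`ρ`, `β ≥ 0`) the mirror sequence `q(n) = Cov_T(F∘ϑ, F_n)` of a bounded observable of the slab `0 ≤ t ≤ T` is `≥ 0` and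
LOG-CONVEX on the window `2T + n ≤ 2S`, and a floor `X ≤ q(u)` at ONE lag propagates OUTWARD with geometric loss
`(X/K²)^{(U−u)/u}` (`…Convex`).  On a finite torus `q` is NOT monotone (past the antipode it grows back), so nothing was
said about lags `n < u`.  Here the INWARD half, which needs no time symmetry of `F`: the same chord inequality read on the
window `[n, N]` with the floor at its INTERIOR point `u` and the trivial ceiling `q(N) ≤ K²` at its far end.

* §1 (real analysis) `pow_le_pow_mul_pow_of_logConvex_window` — `E u ^ (N − n) ≤ E n ^ (N − u) · E N ^ (u − n)` for
  `n ≤ u ≤ N` (the three-point inequality of `…Convex` on the shifted window); `inward_floor_pow_le` — a floor `X ≤ E u`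
  and a ceiling `E N ≤ Y` give `X ^ (N − n) ≤ E n ^ (N − u) · Y ^ (u − n)`, i.e. `E n ≥ X · (X/Y)^{(u−n)/(N−u)}`;
  `le_of_inward` — the Archimedean reading: if `(u − n) · log (Y/X) < (N − u) · log (1/θ)` (`0 < θ < 1`) then `θ·X ≤ E n`.
* §2 (mirror sequence) `mirrorSeq_le_sq` (`q(n) ≤ K²` at EVERY lag, `|F| ≤ K`), `mirrorSeq_pow_le_inward`,
  **`mirrorSeq_floor_propagates_inward`**: `X ≤ q(u)`, `n ≤ u ≤ N`, `2T + N ≤ 2S` ⇒ `X ^ (N − n) ≤ q(n) ^ (N − u) · (K²) ^ (u − n)`;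
  **`mirrorSeq_quasiAntitone`**: `q(n+1) ^ (N − n) ≤ q(n) ^ (N − n − 1) · K²` — the mirror correlator is «antitone up to the
  factor `(K²/q(n))^{1/(N−n)}`», which tends to `1` with the distance `N − n` to the end of the reflection-positive window.
* §3 (route letters `latticeConnectedCorr r.ρ β (2L+1) (W∘Θ₀) W ·`, window cylinders `W` as in `…Torus`)
  `latticeConnectedCorr_mirrorFloor_propagates_inward`, `latticeConnectedCorr_mirror_quasiAntitone`, and the large-torus form
  **`mirrorFloor_inward_of_forall_torus`**: a floor `X ≤ Cov_{2L+1}(W∘Θ₀, τ_{u e₀}W)` on ALL tori `L ≥ L₀` (`X > 0`) forces, for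
  every `θ < 1`, `θ·X ≤ Cov_{2L+1}(W∘Θ₀, τ_{n e₀}W)` at EVERY lag `n ≤ u` on all tori `L ≥ L₁(θ)` — INWARD PROPAGATION IS
  LOSSLESS in the large-torus limit (explicit `L₁`: `2(L₁ − T) − u > u · log(K²/X) / log(1/θ)`).
* §4 (the seam's (MF) letters, `CumulantPolarisationDefs.mirrorForm` / `cubeSmear`) **`mirrorFloor_cubeSmear_inward`**: the (MF)
  floor `X` of the cube `(c + s e₀, b)` on all large tori gives the (MF) floor `θ X` of every cube `(c + s′e₀, b)`, `s′ ≤ s`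
  (the same smearing moved TOWARD the mirror), on all larger tori.

NUMBERS / reading for the crux (owner's / LEAD's pen; nothing registered).  Together with `…Convex`: a β-uniform
clause-(i)/(MF) floor `X` demanded at ONE physical offset `δ` (lag `u = 2δ/a(β)`) on the tori `a(β)·L ≥ Λ₅` holds at every
SMALLER offset with loss factor `(X/K²)^{(u−n)/(2(L−T)−u)} → 1` (`L → ∞`), and at every LARGER offset `U·a/2` with loss
`(X/K²)^{(U−u)/u}` (g10).  So in the limit `L → ∞` along NT's tori the mirror correlator of the witness is a NON-INCREASING
function of the lag on `[0, u]` up to `o(1)`: the registered «floor at one torus-offset» is the floor of a monotone profile,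
hardest exactly AT the witness's offset — moving a witness toward the reflection plane never loses the floor (large tori),
moving it away loses geometrically.  With `K ≍ ‖v‖₁ a(β)⁻⁴`: the torus size beyond which the inward loss is ≤ a factor
`θ` is `L ≳ T + u/2 + (u/2)·(8 log(1/a) + log(C_v/X))/log(1/θ)` — i.e. `a·L ≳ δ·(8 log(1/a(β)))/log(1/θ)`: a LOGARITHMICALLY (in
the unit) larger torus than the witness's own extent, never a power.

Refs: J. Glimm, A. Jaffe, *Quantum Physics* (1987) §6.1; E. Seiler, LNP 159 (1982) Ch. 2 (monotonicity of reflection-positive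
two-point functions in infinite volume = positivity of the transfer matrix; here only finite-torus inequalities are used);
the chord lemma is the tree's `CurvatureKernel.LogConvex.le_chord` via `…Convex.pow_le_pow_mul_pow_of_logConvex`.
-/

set_option autoImplicit false

noncomputable section

open MeasureTheory Finset
open Literature.MathematicalPhysics.QuantumFieldTheory Literature.MathematicalPhysics.QuantumLattice
open Literature.Probability.LatticeModels
open Literature.MathematicalPhysics.QuantumFieldTheory.WilsonRP
open Literature.MathematicalPhysics.QuantumFieldTheory.WilsonOddRP
open Literature.MathematicalPhysics.QuantumFieldTheory.WilsonSiteRP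
open Literature.MathematicalPhysics.QuantumFieldTheory.WilsonNegRP
open Summit.QuantumFields.YangMills.Cruxes.NT.CumulantPolarisation

namespace Summit.QuantumFields.YangMills.Cruxes.NT.MirrorHankel

/-! ## §1 Real analysis: the chord inequality on a shifted window, inward floors -/

section Real

/-- **Three-point inequality on the window `[n, N]`.**  A sequence that is non-negative on `[0, N]` and log-convex at the
interior points (`E v ^ 2 ≤ E (v−1) · E (v+1)`, `0 < v < N`) satisfies `E u ^ (N − n) ≤ E n ^ (N − u) · E N ^ (u − n)` for
`n ≤ u ≤ N` (the inequality of `pow_le_pow_mul_pow_of_logConvex` for the shifted sequence `k ↦ E (n + k)`). [folklore] -/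
theorem pow_le_pow_mul_pow_of_logConvex_window (E : ℕ → ℝ) (N : ℕ) (hnn : ∀ v, v ≤ N → 0 ≤ E v)
    (hlc : ∀ v, 0 < v → v < N → E v ^ 2 ≤ E (v - 1) * E (v + 1)) {n u : ℕ} (hn : n ≤ u) (hu : u ≤ N) :
    E u ^ (N - n) ≤ E n ^ (N - u) * E N ^ (u - n) := by
  have h := pow_le_pow_mul_pow_of_logConvex (fun k => E (n + k)) (N - n)
    (fun v hv => hnn _ (by omega))
    (fun v hv0 hvN => by
      have h1 := hlc (n + v) (by omega) (by omega)
      rwa [show n + v - 1 = n + (v - 1) by omega, show n + v + 1 = n + (v + 1) by omega] at h1)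
    (u := u - n) (by omega)
  rwa [show n + (u - n) = u by omega, show n + (N - n) = N by omega, Nat.add_zero,
    show N - n - (u - n) = N - u by omega] at h

/-- **A floor propagates inward through a log-convex sequence.**  With `E` as above, a floor `X ≤ E u` (`0 ≤ X`) at an
interior point `u` (`n ≤ u ≤ N`) and a ceiling `E N ≤ Y` at the far end give `X ^ (N − n) ≤ E n ^ (N − u) · Y ^ (u − n)`:
the value at the NEAR point `n` is at least `X · (X/Y)^{(u−n)/(N−u)}`. [folklore] -/
theorem inward_floor_pow_le (E : ℕ → ℝ) (N : ℕ) (hnn : ∀ v, v ≤ N → 0 ≤ E v)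
    (hlc : ∀ v, 0 < v → v < N → E v ^ 2 ≤ E (v - 1) * E (v + 1)) {n u : ℕ} (hn : n ≤ u) (hu : u ≤ N) {X Y : ℝ}
    (hX : 0 ≤ X) (hfloor : X ≤ E u) (hceil : E N ≤ Y) :
    X ^ (N - n) ≤ E n ^ (N - u) * Y ^ (u - n) := by
  have h := pow_le_pow_mul_pow_of_logConvex_window E N hnn hlc hn hu
  calc X ^ (N - n) ≤ E u ^ (N - n) := pow_le_pow_left₀ hX hfloor _
    _ ≤ E n ^ (N - u) * E N ^ (u - n) := h
    _ ≤ E n ^ (N - u) * Y ^ (u - n) :=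
        mul_le_mul_of_nonneg_left (pow_le_pow_left₀ (hnn N le_rfl) hceil _) (pow_nonneg (hnn n (by omega)) _)

/-- **The Archimedean reading of the inward inequality.**  If `0 ≤ q`, `0 < X`, `0 < Y`, `0 < θ < 1`, `n ≤ u < N`,
`X ^ (N − n) ≤ q ^ (N − u) · Y ^ (u − n)` and the window is long enough, `(u − n) · log (Y/X) < (N − u) · log (1/θ)`, then
`θ · X ≤ q` (for `θ < 1` the length condition is met by all long windows). [folklore] -/
theorem le_of_inward {q X Y θ : ℝ} {n u N : ℕ} (hq : 0 ≤ q) (hX : 0 < X) (hY : 0 < Y) (hθ : 0 < θ)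
    (hn : n ≤ u) (huN : u < N) (h : X ^ (N - n) ≤ q ^ (N - u) * Y ^ (u - n))
    (hlong : ((u - n : ℕ) : ℝ) * Real.log (Y / X) < ((N - u : ℕ) : ℝ) * Real.log (1 / θ)) :
    θ * X ≤ q := by
  by_contra hcon
  rw [not_le] at hcon
  have hθX : 0 < θ * X := mul_pos hθ hX
  -- `q ^ (N − u) ≤ (θ X)^(N − u)` (strictly smaller base, positive exponent)
  have h1 : q ^ (N - u) ≤ (θ * X) ^ (N - u) := pow_le_pow_left₀ hq hcon.le _
  have h2 : X ^ (N - n) ≤ (θ * X) ^ (N - u) * Y ^ (u - n) :=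
    h.trans (mul_le_mul_of_nonneg_right h1 (pow_nonneg hY.le _))
  -- take logarithms
  have h3 := Real.log_le_log (pow_pos hX _) h2
  rw [Real.log_mul (pow_pos hθX _).ne' (pow_pos hY _).ne', Real.log_pow, Real.log_pow, Real.log_pow,
    Real.log_mul hθ.ne' hX.ne'] at h3
  rw [Real.log_div hY.ne' hX.ne', one_div, Real.log_inv] at hlong
  have hNn : ((N - n : ℕ) : ℝ) = ((N - u : ℕ) : ℝ) + ((u - n : ℕ) : ℝ) := by
    rw [← Nat.cast_add]; congr 1; omega
  rw [hNn] at h3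
  nlinarith [h3, hlong]

end Real

/-! ## §2 The mirror sequence: ceiling at every lag, inward propagation, quasi-antitonicity -/

section Torus

variable {d L N : ℕ} [NeZero d] [NeZero L]
variable {G : Type*} [Group G] [TopologicalSpace G] [IsTopologicalGroup G] [CompactSpace G]
  [MeasurableSpace G] [BorelSpace G] (ρ : G →* Matrix (Fin N) (Fin N) ℂ)

/-- **The trivial ceiling at every lag**: `q(n) = ∫ (F∘ϑ)·F_n − (∫F)² ≤ K²` for `|F| ≤ K`. [folklore] -/
theorem mirrorSeq_le_sq (hρ : Continuous ρ) (β : ℝ) {F : GaugeConfig d L G → ℝ} (hFm : Measurable F) {K : ℝ}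
    (hK : ∀ U, |F U| ≤ K) (n : ℕ) : mirrorSeq ρ β F n ≤ K ^ 2 := by
  haveI := isProbabilityMeasure_wilsonMeasure (d := d) (L := L) ρ hρ β
  rw [mirrorSeq_eq]
  have hϑm : Measurable (GaugeConfig.negReflect : GaugeConfig d L G → GaugeConfig d L G) := measurable_negReflect
  have hKn : ∀ U : GaugeConfig d L G, |timeShift n F U| ≤ K := fun U => hK _
  have hbd : ∀ U : GaugeConfig d L G, F U.negReflect * timeShift n F U ≤ K ^ 2 := fun U => by
    have h := abs_mul (F U.negReflect) (timeShift n F U) ▸ (mul_le_mul (hK U.negReflect) (hKn U) (abs_nonneg _)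
      ((abs_nonneg _).trans (hK U.negReflect)))
    rw [sq]
    exact (le_abs_self _).trans h
  have hint : Integrable (fun U => F U.negReflect * timeShift n F U) (wilsonMeasure ρ β) :=
    Reflection.integrable_wilson_of_bdd ρ hρ β ((hFm.comp hϑm).mul (measurable_timeShift hFm n))
      ⟨K * K, fun U => by
        rw [abs_mul]
        exact mul_le_mul (hK U.negReflect) (hKn U) (abs_nonneg _) ((abs_nonneg _).trans (hK U.negReflect))⟩
  have h1 : ∫ U, F U.negReflect * timeShift n F U ∂(wilsonMeasure ρ β) ≤ ∫ _U, K ^ 2 ∂(wilsonMeasure ρ β) :=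
    integral_mono hint (integrable_const _) hbd
  rw [integral_const, smul_eq_mul, probReal_univ, one_mul] at h1
  nlinarith [sq_nonneg (∫ U, F U ∂(wilsonMeasure ρ β))]

/-- **Three-point inequality for the mirror sequence on the window `[n, N]`** (side `2S+1`, `S ≥ 1`, `β ≥ 0`, `F` a
bounded measurable real observable of the slab `0 ≤ t ≤ T`): `q(u) ^ (N − n) ≤ q(n) ^ (N − u) · q(N) ^ (u − n)` for
`n ≤ u ≤ N` and `2T + N ≤ 2S`. [cite: GlimmJaffe1987, §6.1] -/
theorem mirrorSeq_pow_le_inward {S : ℕ} (hL : L = 2 * S + 1) (hS : 1 ≤ S) (hρ : Continuous ρ) {β : ℝ} (hβ : 0 ≤ β)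
    {F : GaugeConfig d L G → ℝ} (hFm : Measurable F) (hFb : ∃ K : ℝ, ∀ U, |F U| ≤ K) {T : ℕ}
    (hFdep : DependsOn F (slab (d := d) (L := L) 0 T)) {n u N' : ℕ} (hn : n ≤ u) (hu : u ≤ N')
    (hN : 2 * T + N' ≤ 2 * S) :
    mirrorSeq ρ β F u ^ (N' - n) ≤ mirrorSeq ρ β F n ^ (N' - u) * mirrorSeq ρ β F N' ^ (u - n) :=
  pow_le_pow_mul_pow_of_logConvex_window (mirrorSeq ρ β F) N'
    (fun v hv => mirrorSeq_nonneg ρ hL hS hρ hβ hFm hFb hFdep (by omega))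
    (fun v hv0 hvN => by
      have h := mirrorSeq_logConvex ρ hL hS hρ hβ hFm hFb hFdep (n := v - 1) (by omega)
      rwa [show v - 1 + 1 = v by omega, show v - 1 + 2 = v + 1 by omega] at h)
    hn hu

/-- **A mirror floor propagates inward.**  If `X ≤ q(u)` (`0 ≤ X`) at one lag `u`, `n ≤ u ≤ N`, `2T + N ≤ 2S`, and
`|F| ≤ K`, then `X ^ (N − n) ≤ q(n) ^ (N − u) · (K²) ^ (u − n)`: the mirror floor at the SMALLER lag `n` is at least
`X · (X/K²)^{(u−n)/(N−u)}`. [cite: GlimmJaffe1987, §6.1] -/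
theorem mirrorSeq_floor_propagates_inward {S : ℕ} (hL : L = 2 * S + 1) (hS : 1 ≤ S) (hρ : Continuous ρ) {β : ℝ}
    (hβ : 0 ≤ β) {F : GaugeConfig d L G → ℝ} (hFm : Measurable F) {K : ℝ} (hK : ∀ U, |F U| ≤ K) {T : ℕ}
    (hFdep : DependsOn F (slab (d := d) (L := L) 0 T)) {n u N' : ℕ} (hn : n ≤ u) (hu : u ≤ N')
    (hN : 2 * T + N' ≤ 2 * S) {X : ℝ} (hX : 0 ≤ X) (hfloor : X ≤ mirrorSeq ρ β F u) :
    X ^ (N' - n) ≤ mirrorSeq ρ β F n ^ (N' - u) * (K ^ 2) ^ (u - n) :=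
  inward_floor_pow_le (mirrorSeq ρ β F) N'
    (fun v hv => mirrorSeq_nonneg ρ hL hS hρ hβ hFm ⟨K, hK⟩ hFdep (by omega))
    (fun v hv0 hvN => by
      have h := mirrorSeq_logConvex ρ hL hS hρ hβ hFm ⟨K, hK⟩ hFdep (n := v - 1) (by omega)
      rwa [show v - 1 + 1 = v by omega, show v - 1 + 2 = v + 1 by omega] at h)
    hn hu hX hfloor (mirrorSeq_le_sq ρ hρ β hFm hK N')

/-- **Quasi-antitonicity of the mirror sequence.**  For `n + 1 ≤ N`, `2T + N ≤ 2S`, `|F| ≤ K`: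
`q(n+1) ^ (N − n) ≤ q(n) ^ (N − n − 1) · K²` — the ratio `q(n+1)/q(n)` is at most `(K²/q(n+1))^{1/(N−n−1)}`, which tends to
`1` with the distance to the end of the reflection-positive window. [cite: GlimmJaffe1987, §6.1] -/
theorem mirrorSeq_quasiAntitone {S : ℕ} (hL : L = 2 * S + 1) (hS : 1 ≤ S) (hρ : Continuous ρ) {β : ℝ} (hβ : 0 ≤ β)
    {F : GaugeConfig d L G → ℝ} (hFm : Measurable F) {K : ℝ} (hK : ∀ U, |F U| ≤ K) {T : ℕ}
    (hFdep : DependsOn F (slab (d := d) (L := L) 0 T)) {n N' : ℕ} (hn : n + 1 ≤ N') (hN : 2 * T + N' ≤ 2 * S) :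
    mirrorSeq ρ β F (n + 1) ^ (N' - n) ≤ mirrorSeq ρ β F n ^ (N' - n - 1) * K ^ 2 := by
  have h := mirrorSeq_floor_propagates_inward ρ hL hS hρ hβ hFm hK hFdep (n := n) (u := n + 1) (N' := N')
    (Nat.le_succ n) hn hN (mirrorSeq_nonneg ρ hL hS hρ hβ hFm ⟨K, hK⟩ hFdep (by omega)) le_rfl
  rwa [show N' - (n + 1) = N' - n - 1 by omega, show n + 1 - n = 1 by omega, pow_one] at h

end Torus

/-! ## §3 Route letters: window cylinders on the tori `2L+1`, inward propagation, the large-torus form -/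

section RouteLetters

variable {G : Type} [Group G] [TopologicalSpace G] [IsTopologicalGroup G] [CompactSpace G]
  [MeasurableSpace G] [BorelSpace G] {r : LatticeRep G}
variable {W : LGConfig 4 G → ℝ} {SW : Finset (Literature.MathematicalPhysics.QuantumLattice.ZdEdge 4)} {T : ℕ}

/-- **A mirror floor propagates inward (route letters).**  For a bounded measurable cylinder `W` with links based at times in
`[0, T−1]` (`|W| ≤ K`), `β ≥ 0`, an odd torus `2L+1 ≥ 3` and lags `n ≤ u ≤ N` with `2T + N ≤ 2L`: a floor
`X ≤ Cov_T(W∘Θ₀, τ_{u e₀}W)` (`0 ≤ X`) forces `X ^ (N − n) ≤ Cov_T(W∘Θ₀, τ_{n e₀}W) ^ (N − u) · (K²) ^ (u − n)`.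
[cite: OsterwalderSeiler1978, §2] -/
theorem latticeConnectedCorr_mirrorFloor_propagates_inward {β : ℝ} (hβ : 0 ≤ β) {L : ℕ} (hL : 1 ≤ L)
    (hWm : Measurable W) {K : ℝ} (hK : ∀ V, |W V| ≤ K) (hWS : IsCylinder W SW)
    (hw : ∀ e ∈ SW, 0 ≤ e.1 0 ∧ e.1 0 + 1 ≤ T) {n u N' : ℕ} (hn : n ≤ u) (hu : u ≤ N') (hN : 2 * T + N' ≤ 2 * L)
    {X : ℝ} (hX : 0 ≤ X) (hfloor : X ≤ latticeConnectedCorr r.ρ β (2 * L + 1) (fun V => W (cfgReflect V)) W u) :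
    X ^ (N' - n) ≤
      latticeConnectedCorr r.ρ β (2 * L + 1) (fun V => W (cfgReflect V)) W n ^ (N' - u) * (K ^ 2) ^ (u - n) := by
  obtain ⟨hm, -, hdep⟩ := lift_hyps hWm hK hWS hw (L := L) (by omega)
  rw [← mirrorSeq_torusLift] at hfloor ⊢
  exact mirrorSeq_floor_propagates_inward r.ρ (S := L) rfl hL r.continuous hβ hm (fun U => hK _) hdep hn hu hN hX
    hfloor

/-- **Quasi-antitonicity of the mirror correlator (route letters)**: `C(n+1) ^ (N − n) ≤ C(n) ^ (N − n − 1) · K²` for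
`n + 1 ≤ N`, `2T + N ≤ 2L`. [cite: OsterwalderSeiler1978, §2] -/
theorem latticeConnectedCorr_mirror_quasiAntitone {β : ℝ} (hβ : 0 ≤ β) {L : ℕ} (hL : 1 ≤ L)
    (hWm : Measurable W) {K : ℝ} (hK : ∀ V, |W V| ≤ K) (hWS : IsCylinder W SW)
    (hw : ∀ e ∈ SW, 0 ≤ e.1 0 ∧ e.1 0 + 1 ≤ T) {n N' : ℕ} (hn : n + 1 ≤ N') (hN : 2 * T + N' ≤ 2 * L) :
    latticeConnectedCorr r.ρ β (2 * L + 1) (fun V => W (cfgReflect V)) W (n + 1) ^ (N' - n) ≤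
      latticeConnectedCorr r.ρ β (2 * L + 1) (fun V => W (cfgReflect V)) W n ^ (N' - n - 1) * K ^ 2 := by
  obtain ⟨hm, -, hdep⟩ := lift_hyps hWm hK hWS hw (L := L) (by omega)
  rw [← mirrorSeq_torusLift, ← mirrorSeq_torusLift]
  exact mirrorSeq_quasiAntitone r.ρ (S := L) rfl hL r.continuous hβ hm (fun U => hK _) hdep hn hN

/-- **Inward propagation is lossless in the large-torus limit.**  For a bounded measurable window cylinder `W` (links based at
times in `[0, T−1]`, `|W| ≤ K`, `0 < K`) and `β ≥ 0`: if the mirror floor `X ≤ Cov_{2L+1}(W∘Θ₀, τ_{u e₀}W)` (`X > 0`) holds on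
EVERY torus `L ≥ L₀`, then for every `θ ∈ (0, 1)` there is `L₁` (any `L₁ ≥ max L₀ (T + u + M + 1)` with
`u · log(K²/X) < M · log(1/θ)` will do) such that `θ · X ≤ Cov_{2L+1}(W∘Θ₀, τ_{n e₀}W)` for all `L ≥ L₁` and ALL
lags `n ≤ u`. [cite: GlimmJaffe1987, §6.1] -/
theorem mirrorFloor_inward_of_forall_torus {β : ℝ} (hβ : 0 ≤ β) (hWm : Measurable W) {K : ℝ} (hKpos : 0 < K)
    (hK : ∀ V, |W V| ≤ K) (hWS : IsCylinder W SW) (hw : ∀ e ∈ SW, 0 ≤ e.1 0 ∧ e.1 0 + 1 ≤ T) {u L₀ : ℕ} {X : ℝ}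
    (hX : 0 < X)
    (hfloor : ∀ L : ℕ, L₀ ≤ L → X ≤ latticeConnectedCorr r.ρ β (2 * L + 1) (fun V => W (cfgReflect V)) W u)
    {θ : ℝ} (hθ : 0 < θ) (hθ1 : θ < 1) :
    ∃ L₁ : ℕ, ∀ L : ℕ, L₁ ≤ L → ∀ n : ℕ, n ≤ u →
      θ * X ≤ latticeConnectedCorr r.ρ β (2 * L + 1) (fun V => W (cfgReflect V)) W n := by
  -- choose the window length: `M` lags beyond `u` with `u · log(K²/X) < M · log(1/θ)`
  have hlog : 0 < Real.log (1 / θ) := Real.log_pos (by rw [lt_div_iff₀ hθ, one_mul]; exact hθ1)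
  obtain ⟨M, hM⟩ := exists_nat_gt ((u : ℝ) * Real.log (K ^ 2 / X) / Real.log (1 / θ))
  refine ⟨max L₀ (T + u + M + 1), fun L hL n hn => ?_⟩
  have hL0 : L₀ ≤ L := le_trans (le_max_left _ _) hL
  have hLT : T + u + M + 1 ≤ L := le_trans (le_max_right _ _) hL
  have hL1 : 1 ≤ L := by omega
  -- the window `[n, N]`, `N = u + M + (L − T − u − M) ≥ u + M`, with `2T + N ≤ 2L`
  set N' : ℕ := 2 * L - 2 * T with hN'
  have huN : u < N' + 1 := by omega
  have hN : 2 * T + N' ≤ 2 * L := by omega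
  have h := latticeConnectedCorr_mirrorFloor_propagates_inward (r := r) hβ hL1 hWm hK hWS hw hn (by omega) hN hX.le
    (hfloor L hL0)
  have hq : 0 ≤ latticeConnectedCorr r.ρ β (2 * L + 1) (fun V => W (cfgReflect V)) W n :=
    latticeConnectedCorr_mirror_nonneg (r := r) hβ hL1 hWm hK hWS hw (by omega)
  refine le_of_inward hq hX (pow_pos hKpos 2) hθ hn (by omega) h ?_
  -- the window is long enough: `(u − n) log(K²/X) ≤ u log(K²/X) < M log(1/θ) ≤ (N − u) log(1/θ)`
  have hKX : 0 ≤ Real.log (K ^ 2 / X) := by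
    have h1 : X ≤ K ^ 2 := by
      have := hfloor L hL0
      obtain ⟨hm, -, hdep⟩ := lift_hyps hWm hK hWS hw (L := L) (by omega)
      rw [← mirrorSeq_torusLift] at this
      exact this.trans (mirrorSeq_le_sq r.ρ r.continuous β hm (fun U => hK _) u)
    exact Real.log_nonneg (by rw [le_div_iff₀ hX, one_mul]; exact h1)
  have h1 : ((u - n : ℕ) : ℝ) * Real.log (K ^ 2 / X) ≤ (u : ℝ) * Real.log (K ^ 2 / X) :=
    mul_le_mul_of_nonneg_right (by exact_mod_cast Nat.sub_le u n) hKX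
  have h2 : (u : ℝ) * Real.log (K ^ 2 / X) < (M : ℝ) * Real.log (1 / θ) := by
    rw [div_lt_iff₀ hlog] at hM; exact hM
  have h3 : (M : ℝ) * Real.log (1 / θ) ≤ ((N' - u : ℕ) : ℝ) * Real.log (1 / θ) :=
    mul_le_mul_of_nonneg_right (by exact_mod_cast (show M ≤ N' - u by omega)) hlog.le
  linarith

/-- **Corollary (half the floor, every smaller lag).**  Under the same hypotheses there is `L₁` with
`X/2 ≤ Cov_{2L+1}(W∘Θ₀, τ_{n e₀}W)` for all `L ≥ L₁`, `n ≤ u`. [cite: GlimmJaffe1987, §6.1] -/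
theorem mirrorFloor_inward_half_of_forall_torus {β : ℝ} (hβ : 0 ≤ β) (hWm : Measurable W) {K : ℝ} (hKpos : 0 < K)
    (hK : ∀ V, |W V| ≤ K) (hWS : IsCylinder W SW) (hw : ∀ e ∈ SW, 0 ≤ e.1 0 ∧ e.1 0 + 1 ≤ T) {u L₀ : ℕ} {X : ℝ}
    (hX : 0 < X)
    (hfloor : ∀ L : ℕ, L₀ ≤ L → X ≤ latticeConnectedCorr r.ρ β (2 * L + 1) (fun V => W (cfgReflect V)) W u) :
    ∃ L₁ : ℕ, ∀ L : ℕ, L₁ ≤ L → ∀ n : ℕ, n ≤ u →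
      X / 2 ≤ latticeConnectedCorr r.ρ β (2 * L + 1) (fun V => W (cfgReflect V)) W n := by
  obtain ⟨L₁, h⟩ := mirrorFloor_inward_of_forall_torus (r := r) hβ hWm hKpos hK hWS hw hX hfloor one_half_pos
    one_half_lt_one
  exact ⟨L₁, fun L hL n hn => by have := h L hL n hn; linarith⟩

end RouteLetters

/-! ## §4 The seam's (MF) letters: moving the witness cube toward the mirror -/

section MirrorForm

variable {G : Type} [Group G] [TopologicalSpace G] [IsTopologicalGroup G] [CompactSpace G]
  [MeasurableSpace G] [BorelSpace G] {r : LatticeRep G}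

/-- **(MF) floor of the cube at offset `s` on all large tori ⇒ (MF) floor `θ X` at every smaller offset `s′ ≤ s`.**  For a
cube `(c, b)` with `0 ≤ c 0`, weights `w`, the smearing `Ṽ_c = cubeSmear G r c b w` measurable with `|Ṽ_c| ≤ K`, `0 < K`,
carried by a link set `SW` in the cube window, and `β ≥ 0`: if `X ≤ mirrorForm G r β L Ṽ_{c+se₀} Ṽ_{c+se₀}` (`X > 0`) for
all `L ≥ L₀`, then for every `θ ∈ (0,1)` there is `L₁` with `θ · X ≤ mirrorForm G r β L Ṽ_{c+s′e₀} Ṽ_{c+s′e₀}` for all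
`L ≥ L₁` and all `s′ ≤ s`. [cite: GlimmJaffe1987, §6.1] -/
theorem mirrorFloor_cubeSmear_inward {β : ℝ} (hβ : 0 ≤ β) {c : Fin 4 → ℤ} {b : ℕ} (hc0 : 0 ≤ c 0)
    {w : (Fin 4 → ℤ) → ℝ} (hWm : Measurable (cubeSmear G r c b w)) {K : ℝ} (hKpos : 0 < K)
    (hK : ∀ V, |cubeSmear G r c b w V| ≤ K)
    {SW : Finset (Literature.MathematicalPhysics.QuantumLattice.ZdEdge 4)} (hWS : IsCylinder (cubeSmear G r c b w) SW)
    (hSW : ∀ e ∈ SW, ∀ j, c j ≤ e.1 j ∧ e.1 j ≤ c j + b) {s L₀ : ℕ} {X : ℝ} (hX : 0 < X)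
    (hfloor : ∀ L : ℕ, L₀ ≤ L →
      X ≤ mirrorForm G r β L (cubeSmear G r (c + Pi.single 0 (s : ℤ)) b (fun y => w (y - Pi.single 0 (s : ℤ))))
        (cubeSmear G r (c + Pi.single 0 (s : ℤ)) b (fun y => w (y - Pi.single 0 (s : ℤ)))))
    {θ : ℝ} (hθ : 0 < θ) (hθ1 : θ < 1) :
    ∃ L₁ : ℕ, ∀ L : ℕ, L₁ ≤ L → ∀ s' : ℕ, s' ≤ s →
      θ * X ≤ mirrorForm G r β L (cubeSmear G r (c + Pi.single 0 (s' : ℤ)) b (fun y => w (y - Pi.single 0 (s' : ℤ))))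
        (cubeSmear G r (c + Pi.single 0 (s' : ℤ)) b (fun y => w (y - Pi.single 0 (s' : ℤ)))) := by
  obtain ⟨L₁, h⟩ := mirrorFloor_inward_of_forall_torus (r := r) (T := (c 0).toNat + b + 1) hβ hWm hKpos hK hWS
    (window_of_cube hc0 hSW) (u := 2 * s) hX (fun L hL => by rw [← mirrorForm_cubeSmear_eq]; exact hfloor L hL) hθ hθ1
  exact ⟨L₁, fun L hL s' hs' => by rw [mirrorForm_cubeSmear_eq]; exact h L hL (2 * s') (by omega)⟩

end MirrorForm

end Summit.QuantumFields.YangMills.Cruxes.NT.MirrorHankel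

end
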